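import Mathlib
import HarnessLib
import Literature.Probability.LatticeModels.SubmultiplicativeTreeWeight

/-!
# K3 ENGINE child (stmt-HubbardSuperconductivity-20437), stub (b) conjunct 3 ((E4)ₙ supply, part (i) «smeared import», plan g17 KL STATUS
# 2026-08-27 l.3017): the weighted `L¹` norm of a STAR CONVOLUTION (a smeared local vertex) is at most the product of the weighted `L¹`
# norms of its legs

Cell gate-hubbard-kl, seat hubbard-kl-k3c3-p2 (g7).  Generic bookkeeping over `Literature.Probability.LatticeModels.SubmultiplicativeTreeWeight`
(the diameter weights `wt S = 1 + Λ · diam_d S`, of which `EngineV8.klScaleWt` is the instance `Λ = Λ_n`, `d = gridLabelDist`).  A LOCAL vertex of a lattice field theory, read through momentum-space sector / cutoff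
functions on each leg, becomes the STAR CONVOLUTION `L(x₀, …, x_k) = Σ_y Π_i f_i(x_i − y)` of the position-space kernels
`f_i` of the leg functions (Benfatto–Giuliani–Mastropietro 2006, §2.3 (2.37)–(2.40): the sectorised kernels; §3
(3.2)–(3.8): their decay-weighted `L¹` norms).  With one leg pinned at `x₀` and the linear diameter weight, the weighted
`L¹` norm of `L` factorises leg by leg:

  `Σ_{x₁…x_k} (1 + Λ·diam{x₀,…,x_k}) · ‖Σ_y Π_i f_i(x_i − y)‖ ≤ Π_i Σ_z (1 + Λ·δ(z)) · ‖f_i(z)‖`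

for a translation-invariant label pseudo-distance `d(a,b) = δ(a − b)` on a finite abelian group of positions and
`Λ ≥ 0` — because `diam{x_i} ≤ Σ_i δ(x_i − y)` for every centre `y` and `1 + Λ·Σ_i a_i ≤ Π_i (1 + Λ·a_i)`.

* `labelDiam_image_le_sum_dist` — `diam_d (image v) ≤ Σ_i d(v i, c)` for every centre `c`;
* `one_add_mul_sum_le_prod_one_add_mul` — `1 + Λ·Σ_i a_i ≤ Π_i (1 + Λ·a_i)` (`Λ, a_i ≥ 0`);
* `one_add_mul_labelDiam_image_le_prod` — the weight of a tuple is at most the product of the leg weights to any centre;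
* **`sum_diamWeight_mul_norm_starConv_le`** — the factorised bound above (`k + 1` legs, leg `0` pinned).

Consumer: the localisation lemma of the (E4)ₙ supply chain — the import part of the level-`n` sectorised quartic kernel at the flow frame is
`value × (star convolution of the four level-n sector kernels)`, so its `klScaleWt n`-weighted per-tuple sum is `≤ |value| × Π_i T_w(ω_i)` with
`T_w` the weighted torus sums of the sector functions (p3's W1).  Everything is proved; no definitions; nothing about the model is asserted.
References: Benfatto–Giuliani–Mastropietro 2006 §2.3 (2.37)–(2.40), §3 (3.2)–(3.8); Gentile–Mastropietro 2001 §4.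
-/

noncomputable section

open Finset

namespace Summit.HubbardSuperconductivity.HubbardSuperconductivity.Theorems.EngineV8

set_option linter.dupNamespace false -- summit = problem name (single-conjunct summit), D-0017

open Literature.Probability.LatticeModels Literature.Probability.LatticeModels.BattleFederbush

/-! ### The diameter of a tuple against a centre -/

section Diam

variable {Λ : Type*} [DecidableEq Λ]

/-- **The diameter of a finite tuple is at most the sum of the distances of its entries to any centre**:
`diam_d (image v) ≤ Σ_i d(v i, c)`. -/
theorem labelDiam_image_le_sum_dist {d : Λ → Λ → ℝ} (hd : IsLabelDist d) {ι : Type*} [Fintype ι] [DecidableEq ι]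
    (v : ι → Λ) (c : Λ) : labelDiam d (univ.image v) ≤ ∑ i, d (v i) c := by
  have h0 : ∀ i, 0 ≤ d (v i) c := fun i => hd.nonneg _ _
  refine labelDiam_le d (sum_nonneg fun i _ => h0 i) fun a ha b hb => ?_
  obtain ⟨i, -, rfl⟩ := mem_image.1 ha
  obtain ⟨j, -, rfl⟩ := mem_image.1 hb
  by_cases hij : i = j
  · subst hij
    rw [hd.self]
    exact sum_nonneg fun k _ => h0 k
  · calc d (v i) (v j) ≤ d (v i) c + d c (v j) := hd.triangle _ _ _
      _ = d (v i) c + d (v j) c := by rw [hd.symm c (v j)]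
      _ = ∑ k ∈ ({i, j} : Finset ι), d (v k) c := by rw [sum_pair hij]
      _ ≤ ∑ k, d (v k) c := sum_le_sum_of_subset_of_nonneg (subset_univ _) fun k _ _ => h0 k

/-- `1 + Λ·Σ_i a_i ≤ Π_i (1 + Λ·a_i)` for `Λ ≥ 0` and `a_i ≥ 0`. -/
theorem one_add_mul_sum_le_prod_one_add_mul {ι : Type*} (s : Finset ι) {a : ι → ℝ} {c : ℝ} (hc : 0 ≤ c)
    (ha : ∀ i ∈ s, 0 ≤ a i) : 1 + c * ∑ i ∈ s, a i ≤ ∏ i ∈ s, (1 + c * a i) := by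
  classical
  induction s using Finset.induction_on with
  | empty => simp
  | @insert j s hj ih =>
    have ha' : ∀ i ∈ s, 0 ≤ a i := fun i hi => ha i (mem_insert_of_mem hi)
    have hj0 : 0 ≤ a j := ha j (mem_insert_self j s)
    have ih' := ih ha'
    have hs0 : 0 ≤ ∑ i ∈ s, a i := sum_nonneg ha'
    rw [sum_insert hj, prod_insert hj]
    have h1 : 0 ≤ c * a j := mul_nonneg hc hj0
    have h2 : 1 ≤ ∏ i ∈ s, (1 + c * a i) := by
      refine le_trans (le_add_of_nonneg_right (mul_nonneg hc hs0)) ih'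
    nlinarith [mul_nonneg h1 (sub_nonneg.2 h2), mul_nonneg h1 hs0]

/-- **The linear diameter weight of a tuple is at most the product of the leg weights to any centre**:
`1 + Λ·diam_d (image v) ≤ Π_i (1 + Λ·d(v i, c))` (`Λ ≥ 0`). -/
theorem one_add_mul_labelDiam_image_le_prod {d : Λ → Λ → ℝ} (hd : IsLabelDist d) {ι : Type*} [Fintype ι] [DecidableEq ι]
    (v : ι → Λ) (c : Λ) {lam : ℝ} (hlam : 0 ≤ lam) :
    1 + lam * labelDiam d (univ.image v) ≤ ∏ i, (1 + lam * d (v i) c) := by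
  refine le_trans ?_ (one_add_mul_sum_le_prod_one_add_mul univ hlam fun i _ => hd.nonneg _ _)
  have := mul_le_mul_of_nonneg_left (labelDiam_image_le_sum_dist hd v c) hlam
  linarith

end Diam

/-! ### The star convolution -/

section Star

variable {P : Type*} [AddCommGroup P] [Fintype P] [DecidableEq P]

/-- **The weighted `L¹` norm of a star convolution factorises over the legs.**  Positions in a finite abelian group
`P`, a translation-invariant label pseudo-distance `d(a, b) = δ(a − b)`, `Λ ≥ 0`, leg kernels `f₀, …, f_k : P → ℂ`;
with leg `0` pinned at `x₀`:
`Σ_{x : Fin k → P} (1 + Λ·diam_d {x₀, x₁, …, x_k}) · ‖Σ_y Π_i f_i((x₀ :: x) i − y)‖ ≤ Π_i Σ_z (1 + Λ·δ z)·‖f_i z‖`. -/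
theorem sum_diamWeight_mul_norm_starConv_le (δ : P → ℝ) (hd : IsLabelDist (fun a b : P => δ (a - b))) {lam : ℝ}
    (hlam : 0 ≤ lam) {k : ℕ} (f : Fin (k + 1) → P → ℂ) (x₀ : P) :
    ∑ x : Fin k → P,
        (1 + lam * labelDiam (fun a b : P => δ (a - b)) (univ.image (Matrix.vecCons x₀ x))) *
          ‖∑ y : P, ∏ i : Fin (k + 1), f i (Matrix.vecCons x₀ x i - y)‖ ≤
      ∏ i : Fin (k + 1), ∑ z : P, (1 + lam * δ z) * ‖f i z‖ := by
  -- the weighted leg kernels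
  set g : Fin (k + 1) → P → ℝ := fun i z => (1 + lam * δ z) * ‖f i z‖ with hg
  have hδ0 : ∀ z : P, 0 ≤ δ z := fun z => by simpa using hd.nonneg z 0
  have hg0 : ∀ i z, 0 ≤ g i z := fun i z => mul_nonneg (by have := hδ0 z; nlinarith) (norm_nonneg _)
  -- step 1: pointwise, weight × ‖star‖ ≤ Σ_y Π_i g_i(v i − y)
  have hpt : ∀ x : Fin k → P,
      (1 + lam * labelDiam (fun a b : P => δ (a - b)) (univ.image (Matrix.vecCons x₀ x))) *
          ‖∑ y : P, ∏ i : Fin (k + 1), f i (Matrix.vecCons x₀ x i - y)‖ ≤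
        ∑ y : P, ∏ i : Fin (k + 1), g i (Matrix.vecCons x₀ x i - y) := by
    intro x
    set v := Matrix.vecCons x₀ x with hv
    have hw0 : 0 ≤ 1 + lam * labelDiam (fun a b : P => δ (a - b)) (univ.image v) := by
      have := labelDiam_nonneg (fun a b : P => δ (a - b)) (univ.image v); nlinarith
    calc (1 + lam * labelDiam (fun a b : P => δ (a - b)) (univ.image v)) * ‖∑ y : P, ∏ i, f i (v i - y)‖
        ≤ (1 + lam * labelDiam (fun a b : P => δ (a - b)) (univ.image v)) * ∑ y : P, ∏ i, ‖f i (v i - y)‖ := by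
          refine mul_le_mul_of_nonneg_left ((norm_sum_le _ _).trans (sum_le_sum fun y _ => ?_)) hw0
          rw [norm_prod]
      _ = ∑ y : P, (1 + lam * labelDiam (fun a b : P => δ (a - b)) (univ.image v)) * ∏ i, ‖f i (v i - y)‖ := by
          rw [mul_sum]
      _ ≤ ∑ y : P, ∏ i, g i (v i - y) := sum_le_sum fun y _ => by
          have hwy := one_add_mul_labelDiam_image_le_prod hd v y hlam
          calc (1 + lam * labelDiam (fun a b : P => δ (a - b)) (univ.image v)) * ∏ i, ‖f i (v i - y)‖
              ≤ (∏ i, (1 + lam * δ (v i - y))) * ∏ i, ‖f i (v i - y)‖ :=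
                mul_le_mul_of_nonneg_right hwy (prod_nonneg fun i _ => norm_nonneg _)
            _ = ∏ i, g i (v i - y) := by rw [← prod_mul_distrib]
  -- step 2: sum over x and swap
  refine (sum_le_sum fun x _ => hpt x).trans ?_
  rw [sum_comm]
  -- step 3: for each y, split off leg 0 and factorise the free legs
  have hsplit : ∀ y : P, ∑ x : Fin k → P, ∏ i : Fin (k + 1), g i (Matrix.vecCons x₀ x i - y) =
      g 0 (x₀ - y) * ∏ j : Fin k, ∑ z : P, g j.succ z := by
    intro y
    have h1 : ∀ x : Fin k → P, ∏ i : Fin (k + 1), g i (Matrix.vecCons x₀ x i - y) =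
        g 0 (x₀ - y) * ∏ j : Fin k, g j.succ (x j - y) := fun x => by
      rw [Fin.prod_univ_succ]
      simp only [Matrix.cons_val_zero, Matrix.cons_val_succ]
    simp_rw [h1]
    rw [← mul_sum, ← Fintype.prod_sum (fun (j : Fin k) (z : P) => g j.succ (z - y))]
    congr 1
    refine prod_congr rfl fun j _ => ?_
    exact Fintype.sum_equiv (Equiv.subRight y) _ _ fun z => rfl
  simp_rw [hsplit]
  rw [← sum_mul, Fin.prod_univ_succ]
  refine le_of_eq ?_
  congr 1
  -- Σ_y g 0 (x₀ − y) = Σ_z g 0 z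
  exact Fintype.sum_equiv (Equiv.subLeft x₀) _ _ fun y => rfl

end Star

end Summit.HubbardSuperconductivity.HubbardSuperconductivity.Theorems.EngineV8

end
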